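import Summits.QuantumFields.YangMills.Theorems.BalabanUVNodesN05SubBHKnitUnivOfThm33Lin
import Literature.MathematicalPhysics.QuantumFieldTheory.Balaban1983to89.B8Prop6CubeMemberOfThm33Beta

/-!
# BalabanUVNodes ∕ N05 ([Balaban1985RegularSpaces] Lemma 1 – Thm 8): THE J-N06→N05 JUNCTION APPLIED ON THE `Ω₀ = ℤᵈ` ROAD WITH PROPOSITION 6 KNIT IN — the
# junction-applied `Ω₀ = ℤᵈ`-keyed N05 knit `BalabanUVNodesN05SubBHKnitUnivOfThm33Lin` (p558407, guarded additivity letter) with its displayed Proposition-6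
# binder `p6 : B8.Prop6Printed … (cubB8OfRecord θ ·.1)` SUPPLIED BY NAME from the SAME `h33 : B9.Thm33Printed` through dag-n05-e's
# uniform β letter `B8Prop6CubeMemberOfThm33Beta.prop6Printed_zdCub_of_thm33β_uniform` (p563537); `c₁` PRODUCED, the consumer's threshold `B₁⁰` kept

Track A of `YM-PLAN.md` (cell `pub-ymgap`, HUMAN RULING D-0062), node **N05**; seat `pub-ymgap-dag-n05-d` (g9), 2026-08-27; strategy s2 (by-name knit at the record
from the typed interfaces of the in-edge N06 and of the sibling cube road).  Inputs BY NAME: this seat's `exists_b8LeafOfRecordSubBH_cutSubB_zdLan_of_thm33_lettersRDU_univ_lin`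
(p558407) — the J-N06→N05 junction applied on the `Ω₀ = ℤᵈ` road, Proposition 6 displayed as `(B₁⁰ c₁) (p6 : B8.Prop6Printed …)`; dag-n05-e's
`prop6Printed_zdCub_of_thm33β_uniform` (p563537; `∃ B₀ˢ ≥ 1` FIRST, then for all `B₀′ᶜ, c_u, c_P > 0` and Proposition 5's three plain sockets at the cube sub-family of
(1.131), `∃ c₁ > 0` with `B8.Prop6Printed d L (5dL·B₀ˢ) c₁ (zdCub ∘ f)` for EVERY index map `f` — the plug shape this seat asked for in `P6-PLUG-T3.md` item 1; underneath:
dag-n06-b's β junction `B9SupplySockB9P3ZdBeta.sockB9P3D4β_allLevels_of_thm33_on` p541339 and dag-n05-e's β chain `B8LeafKnitZd3CubBdryBeta.prop6Printed_zdCub_of_sockD4βFamily`);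
`Node00.prop6Printed_zdCub_mono` (def-cube).

WHAT IS PROVED (composition BY NAME; no estimate; no new definition):
* ★ **`exists_b8LeafOfRecordSubBH_cutSubB_zdLan_of_thm33_lettersRDU_univ_lin_p6β`** — p558407's statement with the binder `(B₁⁰ c₁ : ℝ) (p6 : B8.Prop6Printed θ.D θ.L B₁⁰ c₁
  (cubB8OfRecord θ ·.1))` REPLACED by: dag-n06-b's member-local dictionary IN EDITION β at the CUBE sub-family of (1.131) (`hdictC hP6C hinvC hcurvC hlanC havgC` =
  `DictAt ∕ Prop6At ∕ InvAt ∕ CurvAt ∕ LandauAt ∕ AvgAtβ`, on the SAME `geo bg GA mem ιCfg ιLoc ops` and constants `c35 c₆ K₆ M₃ a₃ c69 q` as the law-member dictionary),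
  Proposition 5's three plain sockets `SockP5base ∕ SockP5 ∕ SockP5u` at the cube sub-family in the servable shape `hSP5C : ∀ B₀ˢ ≥ 1, ∃ B₀′ᶜ c_u c_P > 0, (∀ i, …) ∧ (∀ i, …) ∧
  (∀ i, …)` (thresholds AFTER the constant), and the bare consumer threshold `(B₁⁰ : ℝ)`; conclusion `∃ inp C₂ B₁′ B₁ B₂ B₀β c₁, 0 < c₁ ∧ B₁⁰ ≤ B₁ ∧ B8LeafOfRecordSubBH θ
  ({lam₀ with inp, C₂, B₁′, B₁, B₂, B₀β}.cutSubB J (zdLan θ.L B₁ ∘ ι) c₁)` (`c₁` PRODUCED).  Proof: the uniform letter gives `B₀ˢ`; `hSP5C B₀ˢ` gives the thresholds and the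
  sockets; the letter gives `c₁` and Proposition 6 on every `zdCub` member, read at `f := fun j : IdxB8SubB θ => j.1.1` (`cubB8OfRecord θ j.1 = zdCub θ.𝔸 θ.L j.1.1`, `rfl`)
  and raised to `max B₁⁰ (5dL·B₀ˢ)` by `prop6Printed_zdCub_mono`; then p558407.  `h33` is read twice (law-member sockets inside p558407; cube-member `p6` here) — ONE
  Theorem 3.3 for both roads.
(The one-token image on p551339 — total-additivity letter `hadd : GopAddAt` for `hlin : LinBddAt` — is the same composition; not filed here: the guarded letter is the
referee-recommended edition, ref-A READ-13.)
AFTER THIS FILE the `Ω₀ = ℤᵈ` road of N05 displays: N06's Theorem 3.3 BY NAME (`h33`); dag-n06-b's operator dictionaries at the law members (R-d ∕ guarded letters) AND at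
the cube members (edition β) — the N06 OBJECT layer ([4] Sect. A + Thm 3.11 as operators), hypotheses; [4] Thm 3.1-type letters at the law members and at the Prop.-5
members (hypotheses, no provider); Proposition 5's three plain sockets at the cube members (hypotheses — N05's Prop.-5 lane there: `SockP5base ∕ SockP5` descend from
`SockHFP₀ ∕ SockHFP` by `B8LeafModelZdOfHFP.sockP5base_of_sockHFP₀ ∕ sockP5_of_sockHFP`, whose cube-member provider of record `B8SockHFPCubeMemberRD.sockHFP_pair_cubeMemberRD`
reads the R-d b9 socket `SB9all` refuted at cube members (`B8JunctionH59Vacuity`), the β body being dag-n05-e's `B8SockHFP59BdryBeta.sockHFP_body_of_join_59_bdryβ`;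
`SockP5u` has NO provider at a cube member — dag-n04-b's `B8SockP5uEAssembly.sockP5uE_of_lettersU` is stated at `Ω₀ = ℤᵈ` — and print's Proposition 6 needs no
uniqueness (p. 99; dag-n05-c `B8Prop6CubeMemberExists` on the R-d road; the β chain's existence-only letter is not typed) — LOCATED, not repaired here); `Prop6At`
(Proposition 6 (1.136) in [4]'s dress (3.35), N05-OWN, at law AND cube members) and `p7` (Proposition 7) — and NO `p6`.
A6 (satisfiability of the member-local binders, director-ym №189 (3)): law-member binders as in p558407 (inhabited at every truncation-0 member by dag-n06-b
`B9SupplySockB9P3ZdAtLin.binders_inhabited_univ_zero_lin` ∕ `B9SupplySockB9P3ZdUnivWitness(Src).binders_inhabited_univ_zero(_src)`; this seat's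
`B8IdxB8LawsCoverZero.binders_inhabited_zero_(lin_)idxB8SubB` keys them on `IdxB8SubB θ`); the cube-member β binders `DictAt ∕ Prop6At ∕ InvAt ∕ CurvAt ∕ LandauAt ∕ AvgAtβ`
(+ `Margin2`, Thm 3.3's block) are inhabited at every cube member at truncation `m = 0` by dag-n06-b `B9SupplySockB9P3ZdBeta.Witness.binders_inhabited_cube_zero` (p541339 §4,
trivial massive regime); members with `m ≥ 1`, `B9.Thm33Printed` itself, the [4] letters and `hSP5C` are NOT witnessed; no joint-satisfiability claim is made.
HONEST FRAMING: kernel bookkeeping by name; every socket ∕ dictionary binder ∕ letter is a HYPOTHESIS; `Prop6At ∕ p7` are HYPOTHESES = N05's own printed members NOT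
discharged; Proposition 6 on the record's cube family is no longer displayed but SUPPLIED modulo the displayed cube-member hypotheses (nothing of [Balaban1985RegularSpaces]
Prop. 6's estimate is proved in this file — the β chain's theorems are cited by name); count-neutral; **N05 NOT discharged**; Bałaban AS PRINTED with locators; constants
sufficient, not optimal; one finite 𝕋⁴ programme at fixed ε; nothing continuum ∕ ℝ⁴ ∕ OS ∕ mass-gap ∕ Clay.  No `sorry`, no new definition.  Unit `pub-ymgap-dag-n05-d` (g9),
2026-08-27.
[cite: Balaban1985RegularSpaces, Lemma 1 p.79, Thm 2 p.83, Prop. 3 p.87, Thm 4 p.88, Prop. 5 (1.106)–(1.110) p.94, Thm 8 (1.146) p.101, Prop. 6 (1.131)–(1.138) pp.98–99 (supplied modulo the displayed hypotheses), Prop. 7 p.100 (named hypothesis), p.77 («Ω_j = T_η»), (1.56)–(1.62) pp.86–87; Balaban1985BackgroundPropagators, Thm 3.3 p.399 (by name), Thm 3.1 p.397, (3.16) p.393, (3.20)–(3.27) pp.394–395, (3.35) p.396, (3.41)–(3.47) pp.397–398, (3.69) p.404 (dictionary hypotheses)]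
-/

noncomputable section

namespace Summit.QuantumFields.YangMills.BalabanUVNodes.N05SubBHKnitUnivOfThm33P6Beta


open Literature.MathematicalPhysics.QuantumFieldTheory.Balaban1983to89
open Literature.MathematicalPhysics.QuantumFieldTheory.Balaban1983to89.Node00
open Literature.MathematicalPhysics.QuantumFieldTheory.Balaban1983to89.B8IdxB8LawsB (towerBonds IdxB8LawsB IdxB8SubB famB8OfRecordSubB)
open Literature.MathematicalPhysics.QuantumFieldTheory.Balaban1983to89.B8LeafModelZd (ZdIdx SockP5base SockP5 SockP5u)
open Literature.MathematicalPhysics.QuantumFieldTheory.Balaban1983to89.B8LeafModelZd3 (SockB9P3)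
open Literature.MathematicalPhysics.QuantumFieldTheory.Balaban1983to89.B8LeafModelZd3H (zdGF3H)
open Literature.MathematicalPhysics.QuantumFieldTheory.Balaban1983to89.B8SockLettersRD (SockLettersRD)
open Literature.MathematicalPhysics.QuantumFieldTheory.Balaban1983to89.B8Lemma1NonAbelian (mulCfg blockPairNA)
open Literature.MathematicalPhysics.QuantumFieldTheory.Balaban1983to89.B8Eq131CubesAdmissible (cubeFam)
open Literature.MathematicalPhysics.QuantumFieldTheory.Balaban1983to89.B8CubeMemberZd (cubeLamS cubeLamB)
open Literature.MathematicalPhysics.QuantumFieldTheory.Balaban1983to89.B8Prop5LandauDataZd (ZdLanIdx zdLan)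
open Literature.MathematicalPhysics.QuantumFieldTheory.Balaban1983to89.B8LanF146 (LanF146)
open Literature.MathematicalPhysics.QuantumFieldTheory.Balaban1983to89.B9SupplySockB9P3ZdLetters (OpsZd)
open Literature.MathematicalPhysics.QuantumFieldTheory.Balaban1983to89.B9SupplySockB9P3ZdAt (DictAt Prop6At InvAt CurvAt LandauAt AvgAt HolderAt SrcAt SrcHolderAt)
open Literature.MathematicalPhysics.QuantumFieldTheory.Balaban1983to89.B9SupplySockB9P3ZdAtLin (LinBddAt)
open Literature.MathematicalPhysics.QuantumFieldTheory.Balaban1983to89.B9SupplySockB9P3ZdBeta (AvgAtβ)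
open Literature.MathematicalPhysics.QuantumFieldTheory.Balaban1983to89.B8Prop6CubeMemberOfThm33Beta (prop6Printed_zdCub_of_thm33β_uniform)
open Summit.QuantumFields.YangMills.BalabanUVNodes.N05SubBHKnitUnivOfThm33Lin (exists_b8LeafOfRecordSubBH_cutSubB_zdLan_of_thm33_lettersRDU_univ_lin)
open MatrixLog B7Prop1Explicit B7Prop2Explicit B7Prop1Local B7Eq92Concrete
open B8Ineq130 (tlo thi)
open B8Ineq132 (InAk covDerivFwd)
open B7Eq78Linearization (zdBlocking QprimeIter)
open B8Eq119TwistedAxial (bgT Restr129 InAx)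
open B8Eq140Level (SideTouches)
open B8Eq138LandauZd (covLap QT InR138 IsLandau146W)
open B8Eq1117Concrete (XSpace)
open B8Prop5ContractionKLevel (Bd2)
open B8LambdaSpaceKLevel (wt)
open B8Eq184Proof (gaugeExp cfgExp)
open B8Eq146AExpansion (iEta)
open B7Prop4GeneralLevels (linCovIter)
open B8Eq155JBound (Jcur wsup)
open B8ScaledSupNorm (bondNorm msup Bdd)
open B9Eq340HolderZd (hquot AdmPair)

-- `Site` alone could resolve to the torus sites of `Setup.lean`; re-export the `ℤ^d` sites of `B7Prop1Explicit`.
export B7Prop1Explicit (Site)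

section P6Discharged

/-- ★ **THE J-N06→N05 JUNCTION APPLIED ON THE `Ω₀ = ℤᵈ` ROAD WITH PROPOSITION 6 KNIT IN (guarded-additivity edition)** — from N06's Theorem 3.3 BY NAME (`h33`),
dag-n06-b's member-local operator dictionary at the `Ω₀ = ℤᵈ` law members (`hdict hP6at hinv hcurv hlan havg hhol hlin hsrc hsrcH`) AND in edition β at the cube members of
(1.131) (`hdictC hP6C hinvC hcurvC hlanC havgC`), [4] Thm 3.1-type letters at the law members (`SLet ∕ SLetUB`) and at the Prop.-5 members (`SLetL ∕ SLetLU`), Proposition 5's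
three plain sockets at the cube members for every constant `B₀ˢ ≥ 1` at some thresholds (`hSP5C`), and N05's printed Proposition 7 (`p7`, for `lam₀`'s axial map): for every
consumer threshold `B₁⁰` THERE EXIST [B9] inputs and constants `inp C₂ B₁′ B₁ B₂ B₀β c₁`, `0 < c₁`, `B₁ ≥ B₁⁰`, with
`B8LeafOfRecordSubBH θ ({lam₀ with inp, C₂, B₁′, B₁, B₂, B₀β}.cutSubB J (zdLan θ.L B₁ ∘ ι) c₁)`.  Proof: dag-n05-e's `prop6Printed_zdCub_of_thm33β_uniform` (`B₀ˢ`, then with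
`hSP5C B₀ˢ` the produced `c₁` and Proposition 6 on every `zdCub` member), `Node00.prop6Printed_zdCub_mono` (raise to `max B₁⁰ (5dL·B₀ˢ)`), then p558407
`exists_b8LeafOfRecordSubBH_cutSubB_zdLan_of_thm33_lettersRDU_univ_lin`.  NOT a discharge of N05: the dictionaries, the letters, the cube-member Prop.-5 sockets, `Prop6At`,
`p7` are hypotheses.
[cite: Balaban1985RegularSpaces, Lemma 1 p.79, Thm 2 p.83, Prop. 3 p.87, Thm 4 p.88, Prop. 5 p.94, Prop. 6 (1.131)–(1.138) pp.98–99, Prop. 7 p.100, Thm 8 (1.146) p.101; Balaban1985BackgroundPropagators, Thm 3.3 p.399, Thm 3.1 p.397, (3.16) p.393] -/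
theorem exists_b8LeafOfRecordSubBH_cutSubB_zdLan_of_thm33_lettersRDU_univ_lin_p6β {θ : Stage3Params} (hD : 2 ≤ θ.D) (lam₀ : ResidB8 θ)
    -- [4] THM 3.1-TYPE LETTERS at the `Ω₀ = ℤᵈ` LAW MEMBERS (existence side on print's domains; uniqueness side) — hypotheses, as in p521275
    {B₀'H B₂' BG BR cL : ℝ} (hB₀'H : 0 < B₀'H) (hB₂' : 0 ≤ B₂') (hBG : 0 ≤ BG) (hBR : 0 ≤ BR) (hcL : 0 < cL)
    (SLet : ∀ i : ZdIdx θ.D θ.L, i.Ω 0 = Set.univ → IdxB8LawsB θ.L i → SockLettersRD (𝔸 := θ.𝔸) θ.L BG BR B₀'H B₂' cL i.η i.k i.Ω i.Λs)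
    (SLetUB : ∀ i : ZdIdx θ.D θ.L, i.Ω 0 = Set.univ → IdxB8LawsB θ.L i → ∀ α₀ : ℝ, 0 < α₀ → α₀ ≤ cL → ∀ U₀ : Site θ.D → Fin θ.D → θ.𝔸ˣ, (∀ x κ, U₀ x κ ∈ unitaryUnits θ.𝔸) →
      InAk θ.L i.k i.η α₀ i.Ω U₀ →
      ∃ (g Δ : (Site θ.D → θ.𝔸) →ₗ[ℂ] (Site θ.D → θ.𝔸)) (q : (Site θ.D → θ.𝔸) →ₗ[ℂ] (ℕ → Site θ.D → θ.𝔸))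
        (qs : (ℕ → Site θ.D → θ.𝔸) →ₗ[ℂ] (Site θ.D → θ.𝔸)) (Aw c : (ℕ → Site θ.D → θ.𝔸) →ₗ[ℂ] (ℕ → Site θ.D → θ.𝔸))
        (H' : XSpace θ.D i.k θ.𝔸 →ₗ[ℂ] (Site θ.D → θ.𝔸)),
        (∀ x : Site θ.D → θ.𝔸, (∃ C : ℝ, ∀ y, ‖x y‖ ≤ C) → g (Δ x + qs (Aw (q x))) = x) ∧ (∀ φ, qs (c (q (g (g (qs φ))))) = qs φ) ∧
        (∀ (f : Site θ.D → θ.𝔸), ∀ x ∈ i.Ω 0, Δ f x = covLap i.η U₀ ((i.Ω 0).indicator f) x) ∧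
        (∀ (μ : ℕ → Site θ.D → θ.𝔸), ∀ x ∈ i.Ω 0, qs μ x = QT θ.L i.k (i.Λs i.k) U₀ μ x) ∧
        (∀ (f : Site θ.D → θ.𝔸) (n : ℕ), n ≤ i.k → ∀ y ∈ i.Λs i.k n, q f n y = QprimeIter (zdBlocking θ.D θ.L) (bgT θ.L U₀) n f y) ∧
        (∀ (f : Site θ.D → θ.𝔸) (n : ℕ) (y : Site θ.D), ¬ (n ≤ i.k ∧ y ∈ i.Λs i.k n) → q f n y = 0) ∧
        (∀ (X : XSpace θ.D i.k θ.𝔸) (x : Site θ.D), ‖H' X x‖ ≤ B₀'H * ‖X‖) ∧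
        (∀ n, n ≤ i.k → ∀ (X : XSpace θ.D i.k θ.𝔸), ∀ p ∈ {b : Site θ.D × Fin θ.D | SideTouches (i.Ω n) b.1 b.2},
          wt θ.L i.η n * ‖covDerivFwd i.η U₀ p.2 (H' X) p.1‖ ≤ B₀'H * ‖X‖) ∧
        (∀ X : XSpace θ.D i.k θ.𝔸, Bd2 θ.L i.η i.k i.Ω (covLap i.η U₀ (H' X)) (B₂' * ‖X‖)) ∧
        (∀ (Y : XSpace θ.D i.k θ.𝔸) (n : ℕ) (hn : n ≤ i.k) (y : Site θ.D), y ∈ i.Λs i.k n →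
          QprimeIter (zdBlocking θ.D θ.L) (bgT θ.L U₀) n (H' Y) y = Y (⟨n, Nat.lt_succ_of_le hn⟩, y)) ∧
        (∀ (f : Site θ.D → θ.𝔸) (r : ℝ), 0 ≤ r → Bd2 θ.L i.η i.k i.Ω f r →
          (∀ x, ‖g f x‖ ≤ BG * r) ∧ ∀ n, n ≤ i.k → ∀ p ∈ {b : Site θ.D × Fin θ.D | SideTouches (i.Ω n) b.1 b.2},
            wt θ.L i.η n * ‖covDerivFwd i.η U₀ p.2 (g f) p.1‖ ≤ BG * r) ∧
        (∀ (f : Site θ.D → θ.𝔸) (r : ℝ), 0 ≤ r → Bd2 θ.L i.η i.k i.Ω f r → Bd2 θ.L i.η i.k i.Ω (f - g (qs (c (q (g f))))) (BR * r)))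
    -- PROPOSITION 5's INDEX READ AS OBJECTS: `zdLan` members obeying the member laws, with [4]'s letters at each (RD currency), as in p521275
    {J : Type} (ι : J → ZdLanIdx θ.D θ.𝔸)
    (hΩ0L : ∀ a : J, (ι a).Ω 0 = Set.univ) (hΩL : ∀ a : J, ∀ j, (ι a).Ω (j + 1) ⊆ (ι a).Ω j)
    (htowerL : ∀ a : J, ∀ j, j ≤ (ι a).k → ∀ y ∈ (ι a).Λ j, ∀ x, InBox (tlo θ.L y j) (thi θ.L y j) x → x ∈ (ι a).Ω j)
    (SLetL : ∀ a : J, ∀ α₀ : ℝ, 0 < α₀ → α₀ ≤ cL → InAk θ.L (ι a).k (ι a).η α₀ (ι a).Ω (ι a).U₀ →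
      ∃ (g Δ : (Site θ.D → θ.𝔸) →ₗ[ℂ] (Site θ.D → θ.𝔸)) (q : (Site θ.D → θ.𝔸) →ₗ[ℂ] (ℕ → Site θ.D → θ.𝔸))
        (qs : (ℕ → Site θ.D → θ.𝔸) →ₗ[ℂ] (Site θ.D → θ.𝔸)) (Aw c : (ℕ → Site θ.D → θ.𝔸) →ₗ[ℂ] (ℕ → Site θ.D → θ.𝔸))
        (H' : XSpace θ.D (ι a).k θ.𝔸 →ₗ[ℂ] (Site θ.D → θ.𝔸)),
        (∀ x, ∀ y ∈ (ι a).Ω 0, (Δ (g x) + qs (Aw (q (g x)))) y = x y) ∧ (∀ f, q (g (g (qs (c (q f))))) = q f) ∧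
        (∀ (f : Site θ.D → θ.𝔸), ∀ x ∈ (ι a).Ω 0, Δ f x = covLap (ι a).η (ι a).U₀ (((ι a).Ω 0).indicator f) x) ∧
        (∀ (μ : ℕ → Site θ.D → θ.𝔸), ∀ x ∈ (ι a).Ω 0, qs μ x = QT θ.L (ι a).k (ι a).Λ (ι a).U₀ μ x) ∧
        (∀ (f : Site θ.D → θ.𝔸) (j : ℕ), j ≤ (ι a).k → ∀ y ∈ (ι a).Λ j, q f j y = QprimeIter (zdBlocking θ.D θ.L) (bgT θ.L (ι a).U₀) j f y) ∧
        (∀ (X : XSpace θ.D (ι a).k θ.𝔸) (x : Site θ.D), ‖H' X x‖ ≤ B₀'H * ‖X‖) ∧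
        (∀ j, j ≤ (ι a).k → ∀ (X : XSpace θ.D (ι a).k θ.𝔸), ∀ p ∈ {b : Site θ.D × Fin θ.D | SideTouches ((ι a).Ω j) b.1 b.2},
          wt θ.L (ι a).η j * ‖covDerivFwd (ι a).η (ι a).U₀ p.2 (H' X) p.1‖ ≤ B₀'H * ‖X‖) ∧
        (∀ X : XSpace θ.D (ι a).k θ.𝔸, Bd2 θ.L (ι a).η (ι a).k (ι a).Ω (covLap (ι a).η (ι a).U₀ (H' X)) (B₂' * ‖X‖)) ∧
        (∀ (X : XSpace θ.D (ι a).k θ.𝔸) (x : Site θ.D), x ∉ (ι a).Ω 0 → H' X x = 0) ∧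
        (∀ X Y : XSpace θ.D (ι a).k θ.𝔸, (∀ p, Y p = -star (X p)) → ∀ x, H' Y x = -star (H' X x)) ∧
        (∀ (Y : XSpace θ.D (ι a).k θ.𝔸) (j : ℕ) (hj : j ≤ (ι a).k) (y : Site θ.D), y ∈ (ι a).Λ j →
          QprimeIter (zdBlocking θ.D θ.L) (bgT θ.L (ι a).U₀) j (H' Y) y = Y (⟨j, Nat.lt_succ_of_le hj⟩, y)) ∧
        (∀ (f : Site θ.D → θ.𝔸) (r : ℝ), 0 ≤ r → Bd2 θ.L (ι a).η (ι a).k (ι a).Ω f r →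
          (∀ x, ‖g f x‖ ≤ BG * r) ∧ ∀ j, j ≤ (ι a).k → ∀ p ∈ {b : Site θ.D × Fin θ.D | SideTouches ((ι a).Ω j) b.1 b.2},
            wt θ.L (ι a).η j * ‖covDerivFwd (ι a).η (ι a).U₀ p.2 (g f) p.1‖ ≤ BG * r) ∧
        (∀ (f : Site θ.D → θ.𝔸) (x : Site θ.D), x ∉ (ι a).Ω 0 → g f x = 0) ∧
        (∀ f : Site θ.D → θ.𝔸, (∀ j, j ≤ (ι a).k → ∀ x ∈ (ι a).Ω j, IsSelfAdjoint (f x)) → ∀ x, IsSelfAdjoint (g f x)) ∧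
        (∀ (f : Site θ.D → θ.𝔸) (r : ℝ), 0 ≤ r → Bd2 θ.L (ι a).η (ι a).k (ι a).Ω f r →
          Bd2 θ.L (ι a).η (ι a).k (ι a).Ω (f - g (qs (c (q (g f))))) (BR * r)) ∧
        (∀ f : Site θ.D → θ.𝔸, (∀ j, j ≤ (ι a).k → ∀ x ∈ (ι a).Ω j, IsSelfAdjoint (f x)) →
          ∀ j, j ≤ (ι a).k → ∀ x ∈ (ι a).Ω j, IsSelfAdjoint ((f - g (qs (c (q (g f))))) x)))
    (SLetLU : ∀ a : J, ∀ α₀ : ℝ, 0 < α₀ → α₀ ≤ cL → InAk θ.L (ι a).k (ι a).η α₀ (ι a).Ω (ι a).U₀ →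
      ∃ (g Δ : (Site θ.D → θ.𝔸) →ₗ[ℂ] (Site θ.D → θ.𝔸)) (q : (Site θ.D → θ.𝔸) →ₗ[ℂ] (ℕ → Site θ.D → θ.𝔸)) (qs : (ℕ → Site θ.D → θ.𝔸) →ₗ[ℂ] (Site θ.D → θ.𝔸))
        (Aw c : (ℕ → Site θ.D → θ.𝔸) →ₗ[ℂ] (ℕ → Site θ.D → θ.𝔸)) (H' : XSpace θ.D (ι a).k θ.𝔸 →ₗ[ℂ] (Site θ.D → θ.𝔸)),
        (∀ x : Site θ.D → θ.𝔸, (∃ C : ℝ, ∀ y, ‖x y‖ ≤ C) → g (Δ x + qs (Aw (q x))) = x) ∧ (∀ φ, qs (c (q (g (g (qs φ))))) = qs φ) ∧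
        (∀ (f : Site θ.D → θ.𝔸), ∀ x ∈ (ι a).Ω 0, Δ f x = covLap (ι a).η (ι a).U₀ (((ι a).Ω 0).indicator f) x) ∧
        (∀ (μ : ℕ → Site θ.D → θ.𝔸), ∀ x ∈ (ι a).Ω 0, qs μ x = QT θ.L (ι a).k (ι a).Λ (ι a).U₀ μ x) ∧
        (∀ (f : Site θ.D → θ.𝔸) (n : ℕ), n ≤ (ι a).k → ∀ y ∈ (ι a).Λ n, q f n y = QprimeIter (zdBlocking θ.D θ.L) (bgT θ.L (ι a).U₀) n f y) ∧
        (∀ (f : Site θ.D → θ.𝔸) (n : ℕ) (y : Site θ.D), ¬ (n ≤ (ι a).k ∧ y ∈ (ι a).Λ n) → q f n y = 0) ∧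
        (∀ (X : XSpace θ.D (ι a).k θ.𝔸) (x : Site θ.D), ‖H' X x‖ ≤ B₀'H * ‖X‖) ∧
        (∀ n, n ≤ (ι a).k → ∀ (X : XSpace θ.D (ι a).k θ.𝔸), ∀ p ∈ {b : Site θ.D × Fin θ.D | SideTouches ((ι a).Ω n) b.1 b.2},
          wt θ.L (ι a).η n * ‖covDerivFwd (ι a).η (ι a).U₀ p.2 (H' X) p.1‖ ≤ B₀'H * ‖X‖) ∧
        (∀ X : XSpace θ.D (ι a).k θ.𝔸, Bd2 θ.L (ι a).η (ι a).k (ι a).Ω (covLap (ι a).η (ι a).U₀ (H' X)) (B₂' * ‖X‖)) ∧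
        (∀ (Y : XSpace θ.D (ι a).k θ.𝔸) (n : ℕ) (hn : n ≤ (ι a).k) (y : Site θ.D), y ∈ (ι a).Λ n →
          QprimeIter (zdBlocking θ.D θ.L) (bgT θ.L (ι a).U₀) n (H' Y) y = Y (⟨n, Nat.lt_succ_of_le hn⟩, y)) ∧
        (∀ (f : Site θ.D → θ.𝔸) (r : ℝ), 0 ≤ r → Bd2 θ.L (ι a).η (ι a).k (ι a).Ω f r →
          (∀ x, ‖g f x‖ ≤ BG * r) ∧ ∀ n, n ≤ (ι a).k → ∀ p ∈ {b : Site θ.D × Fin θ.D | SideTouches ((ι a).Ω n) b.1 b.2},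
            wt θ.L (ι a).η n * ‖covDerivFwd (ι a).η (ι a).U₀ p.2 (g f) p.1‖ ≤ BG * r) ∧
        (∀ (f : Site θ.D → θ.𝔸) (r : ℝ), 0 ≤ r → Bd2 θ.L (ι a).η (ι a).k (ι a).Ω f r →
          Bd2 θ.L (ι a).η (ι a).k (ι a).Ω (f - g (qs (c (q (g f))))) (BR * r)))
    -- N06 BY NAME: [Balaban1985BackgroundPropagators] THEOREM 3.3 as typed by the N06 lineage (the `t33` conjunct of the [B9] leaf), for an abstract indexed
    -- geometry ∕ background ∕ kernel family, and dag-n06-b's member-local OPERATOR DICTIONARY at the `Ω₀ = ℤᵈ` LAW MEMBERS (object layer: the index map `mem`,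
    -- configuration ∕ location transports `ιCfg ∕ ιLoc`, operator letters `ops`) — hypotheses; `Prop6At` is [Balaban1985RegularSpaces] Prop. 6 (1.136) in
    -- [4]'s dress (3.35), N05-OWN content displayed
    {I : Type} (geo : I → B9.Geometry) (bg : I → B9.Backgrounds) (GA : ∀ i, B9.KernelFamily (geo i) (bg i)) {Gp : ∀ i, B9.KernelFamily (geo i) (bg i)}
    (mem : ℝ → ZdIdx θ.D θ.L → ℕ → I)
    (ιCfg : ∀ (M : ℝ) (i : ZdIdx θ.D θ.L) (m : ℕ) (U₀ : Site θ.D → Fin θ.D → θ.𝔸ˣ), (∀ x κ, U₀ x κ ∈ unitaryUnits θ.𝔸) → (bg (mem M i m)).Cfg)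
    (ιLoc : ∀ (M : ℝ) (i : ZdIdx θ.D θ.L) (m : ℕ), (Site θ.D → Fin θ.D → θ.𝔸) → (geo (mem M i m)).Loc)
    (ops : ℝ → ZdIdx θ.D θ.L → ℕ → OpsZd θ.D θ.𝔸)
    {c35 c₆ K₆ M₃ a₃ c69 q CH cS cSβ : ℝ} (h33 : B9.Thm33Printed c35 geo bg Gp GA)
    (hdict : ∀ (M : ℝ) (i : ZdIdx θ.D θ.L), i.Ω 0 = Set.univ → IdxB8LawsB θ.L i → ∀ m : ℕ, DictAt geo bg GA θ.L mem ιCfg ιLoc ops M i m)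
    (hP6at : ∀ (M : ℝ) (i : ZdIdx θ.D θ.L), i.Ω 0 = Set.univ → IdxB8LawsB θ.L i → ∀ m : ℕ, M₃ ≤ M → Prop6At bg θ.L mem ιCfg c35 c₆ K₆ M i m)
    (hinv : ∀ (M : ℝ) (i : ZdIdx θ.D θ.L), i.Ω 0 = Set.univ → IdxB8LawsB θ.L i → ∀ m : ℕ, M₃ ≤ M → InvAt bg θ.L mem ιCfg ops c35 a₃ M i m)
    (hcurv : ∀ (M : ℝ) (i : ZdIdx θ.D θ.L), i.Ω 0 = Set.univ → IdxB8LawsB θ.L i → ∀ m : ℕ, M₃ ≤ M → CurvAt bg θ.L mem ιCfg ops c35 a₃ c69 M i m)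
    (hlan : ∀ (M : ℝ) (i : ZdIdx θ.D θ.L), i.Ω 0 = Set.univ → IdxB8LawsB θ.L i → ∀ m : ℕ, M₃ ≤ M → LandauAt bg θ.L mem ιCfg ops c35 a₃ M i m)
    (havg : ∀ (M : ℝ) (i : ZdIdx θ.D θ.L), i.Ω 0 = Set.univ → IdxB8LawsB θ.L i → ∀ m : ℕ, AvgAt θ.L ops q M i m)
    (hhol : ∀ (M : ℝ) (i : ZdIdx θ.D θ.L), i.Ω 0 = Set.univ → IdxB8LawsB θ.L i → ∀ m : ℕ, HolderAt geo bg GA θ.L mem ιCfg ops lam₀.β lam₀.len CH M i m)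
    (hlin : ∀ (M : ℝ) (i : ZdIdx θ.D θ.L), i.Ω 0 = Set.univ → IdxB8LawsB θ.L i → ∀ m : ℕ, LinBddAt θ.L ops M i m)
    (hsrc : ∀ (M : ℝ) (i : ZdIdx θ.D θ.L), i.Ω 0 = Set.univ → IdxB8LawsB θ.L i → ∀ m : ℕ, M₃ ≤ M → SrcAt bg θ.L mem ιCfg ops c35 a₃ cS M i m)
    (hsrcH : ∀ (M : ℝ) (i : ZdIdx θ.D θ.L), i.Ω 0 = Set.univ → IdxB8LawsB θ.L i → ∀ m : ℕ, M₃ ≤ M →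
      SrcHolderAt bg θ.L mem ιCfg ops c35 a₃ lam₀.β lam₀.len cSβ M i m)
    (hc₆ : 0 < c₆) (hK₆ : 0 < K₆) (ha₃ : 0 < a₃) (hc69 : 0 ≤ c69) (hq : 0 ≤ q) (hcS : 0 ≤ cS) (hcSβ : 0 ≤ cSβ)
    -- dag-n06-b's member-local dictionary IN EDITION β AT THE CUBE SUB-FAMILY of (1.131) (the SAME `mem ιCfg ιLoc ops` and constants; `AvgAtβ` — the (3.16)∕(1.56)
    -- averaging letter whose datum `|B₁|β` carries the level-0 crossing bonds) — hypotheses, read with `h33` by dag-n05-e's uniform `p6` letter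
    (hdictC : ∀ (M : ℝ) (j : {i : ZdIdx θ.D θ.L // ∃ (a : Site θ.D) (M ρ : ℕ), θ.L ≤ ρ ∧ ρ ≤ M ∧ 11 * θ.D < M ∧ θ.L ≤ θ.D * M ∧
          i.Ω = cubeFam false θ.L a M ρ i.k ∧ i.Λs = cubeLamS θ.L a M ρ i.k ∧ i.Λb = cubeLamB θ.L a M ρ i.k}) (m : ℕ),
      DictAt geo bg GA θ.L mem ιCfg ιLoc ops M j.1 m)
    (hP6C : ∀ (M : ℝ) (j : {i : ZdIdx θ.D θ.L // ∃ (a : Site θ.D) (M ρ : ℕ), θ.L ≤ ρ ∧ ρ ≤ M ∧ 11 * θ.D < M ∧ θ.L ≤ θ.D * M ∧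
          i.Ω = cubeFam false θ.L a M ρ i.k ∧ i.Λs = cubeLamS θ.L a M ρ i.k ∧ i.Λb = cubeLamB θ.L a M ρ i.k}) (m : ℕ),
      M₃ ≤ M → Prop6At bg θ.L mem ιCfg c35 c₆ K₆ M j.1 m)
    (hinvC : ∀ (M : ℝ) (j : {i : ZdIdx θ.D θ.L // ∃ (a : Site θ.D) (M ρ : ℕ), θ.L ≤ ρ ∧ ρ ≤ M ∧ 11 * θ.D < M ∧ θ.L ≤ θ.D * M ∧
          i.Ω = cubeFam false θ.L a M ρ i.k ∧ i.Λs = cubeLamS θ.L a M ρ i.k ∧ i.Λb = cubeLamB θ.L a M ρ i.k}) (m : ℕ),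
      M₃ ≤ M → InvAt bg θ.L mem ιCfg ops c35 a₃ M j.1 m)
    (hcurvC : ∀ (M : ℝ) (j : {i : ZdIdx θ.D θ.L // ∃ (a : Site θ.D) (M ρ : ℕ), θ.L ≤ ρ ∧ ρ ≤ M ∧ 11 * θ.D < M ∧ θ.L ≤ θ.D * M ∧
          i.Ω = cubeFam false θ.L a M ρ i.k ∧ i.Λs = cubeLamS θ.L a M ρ i.k ∧ i.Λb = cubeLamB θ.L a M ρ i.k}) (m : ℕ),
      M₃ ≤ M → CurvAt bg θ.L mem ιCfg ops c35 a₃ c69 M j.1 m)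
    (hlanC : ∀ (M : ℝ) (j : {i : ZdIdx θ.D θ.L // ∃ (a : Site θ.D) (M ρ : ℕ), θ.L ≤ ρ ∧ ρ ≤ M ∧ 11 * θ.D < M ∧ θ.L ≤ θ.D * M ∧
          i.Ω = cubeFam false θ.L a M ρ i.k ∧ i.Λs = cubeLamS θ.L a M ρ i.k ∧ i.Λb = cubeLamB θ.L a M ρ i.k}) (m : ℕ),
      M₃ ≤ M → LandauAt bg θ.L mem ιCfg ops c35 a₃ M j.1 m)
    (havgC : ∀ (M : ℝ) (j : {i : ZdIdx θ.D θ.L // ∃ (a : Site θ.D) (M ρ : ℕ), θ.L ≤ ρ ∧ ρ ≤ M ∧ 11 * θ.D < M ∧ θ.L ≤ θ.D * M ∧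
          i.Ω = cubeFam false θ.L a M ρ i.k ∧ i.Λs = cubeLamS θ.L a M ρ i.k ∧ i.Λb = cubeLamB θ.L a M ρ i.k}) (m : ℕ),
      AvgAtβ θ.L ops q M j.1 m)
    -- PROPOSITION 5's THREE PLAIN SOCKETS AT THE CUBE SUB-FAMILY for EVERY input constant `B₀ˢ ≥ 1`, at thresholds `B₀′ᶜ, c_u, c_P` chosen AFTER the constant
    -- (the servable quantifier shape, `P6-PLUG-T3.md` item 1) — hypotheses (N05's Prop.-5 lane at the cube members; `SockP5u` there has no in-tree provider)
    (hSP5C : ∀ B₀S : ℝ, 1 ≤ B₀S → ∃ B₀'c cu cP : ℝ, 0 < B₀'c ∧ 0 < cu ∧ 0 < cP ∧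
      (∀ i : {i : ZdIdx θ.D θ.L // ∃ (a : Site θ.D) (M ρ : ℕ), θ.L ≤ ρ ∧ ρ ≤ M ∧ 11 * θ.D < M ∧ θ.L ≤ θ.D * M ∧
          i.Ω = cubeFam false θ.L a M ρ i.k ∧ i.Λs = cubeLamS θ.L a M ρ i.k ∧ i.Λb = cubeLamB θ.L a M ρ i.k},
          SockP5base (𝔸 := θ.𝔸) θ.L B₀S B₀'c cP i.1.η i.1.k i.1.Ω i.1.Λs) ∧
      (∀ i : {i : ZdIdx θ.D θ.L // ∃ (a : Site θ.D) (M ρ : ℕ), θ.L ≤ ρ ∧ ρ ≤ M ∧ 11 * θ.D < M ∧ θ.L ≤ θ.D * M ∧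
          i.Ω = cubeFam false θ.L a M ρ i.k ∧ i.Λs = cubeLamS θ.L a M ρ i.k ∧ i.Λb = cubeLamB θ.L a M ρ i.k},
          SockP5 (𝔸 := θ.𝔸) θ.L B₀S B₀'c cP i.1.η i.1.k i.1.Ω i.1.Λs) ∧
      (∀ i : {i : ZdIdx θ.D θ.L // ∃ (a : Site θ.D) (M ρ : ℕ), θ.L ≤ ρ ∧ ρ ≤ M ∧ 11 * θ.D < M ∧ θ.L ≤ θ.D * M ∧
          i.Ω = cubeFam false θ.L a M ρ i.k ∧ i.Λs = cubeLamS θ.L a M ρ i.k ∧ i.Λb = cubeLamB θ.L a M ρ i.k},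
          SockP5u (𝔸 := θ.𝔸) θ.L cP cu i.1.η i.1.k i.1.Ω i.1.Λs))
    -- the consumer's Proposition-6 threshold `B₁⁰` (kept: the produced `B₁ ≥ B₁⁰`) and N05's printed Proposition 7 for `lam₀`'s axial map (displayed hypothesis)
    (B₁₀ : ℝ)
    (p7 : B8SectGH.Prop7PrintedR (fun j : IdxB8SubB θ => famB8OfRecordSubB θ lam₀.β lam₀.len j) (fun j => lam₀.toAxial j.1)) :
    ∃ (inp : B8.B9Inputs) (C₂ B₁' B₁ B₂ B₀β c₁ : ℝ), 0 < c₁ ∧ B₁₀ ≤ B₁ ∧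
      B8LeafOfRecordSubBH θ (({ lam₀ with inp := inp, C₂ := C₂, B₁' := B₁', B₁ := B₁, B₂ := B₂, B₀β := B₀β } : ResidB8 θ).cutSubB J
        (fun a : J => zdLan θ.L B₁ (ι a)) c₁) := by
  -- dag-n05-e's UNIFORM `p6` letter: the constant `B₀ˢ ≥ 1` FIRST (from `h33`'s block and the β dictionary at the cube members alone)
  obtain ⟨B₀S, hB₀S, H⟩ := prop6Printed_zdCub_of_thm33β_uniform (𝔸 := θ.𝔸) hD θ.two_le_L geo bg GA mem ιCfg ιLoc ops h33 hdictC hP6C hinvC hcurvC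
    hlanC havgC hc₆ hK₆ ha₃ hc69 hq
  -- Proposition 5's three sockets at the cube members FOR THAT CONSTANT, at the supplier's thresholds; then Proposition 6 on every `zdCub` member
  obtain ⟨B₀'c, cu, cP, hB₀'c, hcu, hcP, SP5base, SP5, SP5u⟩ := hSP5C B₀S hB₀S
  obtain ⟨c₁, hc₁, P6⟩ := H hB₀'c hcu hcP SP5base SP5 SP5u
  -- … read on the record's cube family over the sub-index of record and raised to the consumer's threshold (def-cube's monotonicity)
  have p6 : B8.Prop6Printed θ.D (θ.L : ℝ) (max B₁₀ (5 * (θ.D : ℝ) * θ.L * B₀S)) c₁ (fun j : IdxB8SubB θ => cubB8OfRecord θ j.1) :=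
    prop6Printed_zdCub_mono θ.𝔸 (fun j : IdxB8SubB θ => j.1.1) (le_max_right _ _) le_rfl (P6 (fun j : IdxB8SubB θ => j.1.1))
  -- the junction-applied knit (p558407) at the threshold `max B₁⁰ (5dL·B₀ˢ)` and the produced `c₁`
  obtain ⟨inp, C₂, B₁', B₁, B₂, B₀β, hB₁, hleaf⟩ := exists_b8LeafOfRecordSubBH_cutSubB_zdLan_of_thm33_lettersRDU_univ_lin hD lam₀ hB₀'H hB₂' hBG hBR hcL
    SLet SLetUB ι hΩ0L hΩL htowerL SLetL SLetLU geo bg GA mem ιCfg ιLoc ops h33 hdict hP6at hinv hcurv hlan havg hhol hlin hsrc hsrcH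
    hc₆ hK₆ ha₃ hc69 hq hcS hcSβ (max B₁₀ (5 * (θ.D : ℝ) * θ.L * B₀S)) c₁ p6 p7
  exact ⟨inp, C₂, B₁', B₁, B₂, B₀β, c₁, hc₁, (le_max_left _ _).trans hB₁, hleaf⟩

end P6Discharged

#print axioms exists_b8LeafOfRecordSubBH_cutSubB_zdLan_of_thm33_lettersRDU_univ_lin_p6β

end Summit.QuantumFields.YangMills.BalabanUVNodes.N05SubBHKnitUnivOfThm33P6Beta

end
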